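import Summits.BirchSwinnertonDyer.BirchSwinnertonDyer.Theorems.TwoAdicConverseMultiplicativeInputs
import Summits.BirchSwinnertonDyer.Rank1Residual.X1.MuLambdaAlgebra
import Summits.BirchSwinnertonDyer.Rank1Residual.Additive.TameBranchLambdaParityLaw
import HarnessLib

/-!
# Route `TwoAdicConverse`, multiplicative node: the λ-ROAD to the crux `MultiplicativeRankZeroTwoConverse`
# (stmt-BirchSwinnertonDyer-19219) — Kato `⊗ℚ` + «`λ_an ≤ λ_alg`» ⇒ the K4ᵐ lower half in rank-free
# Iwasawa form (T-mult-4) ⇒ the rank-`0` 2-converse; NO `μ`, NO period integrality, NO `BSD₂`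

WHAT IS PROVED (seat bsd-2adic-conv-2, D-0074 (A) «find: 19219 likewise»; THEOREMS ONLY — no
definition, no named fact, nothing asserted). Currency: `Λ = IwasawaAlgebra 2 = ℤ₂⟦T⟧`,
`ι = iwasawaToPowerSeries 2`, `λ = X1.MuLambda.lam`, `μ = X1.MuLambda.mu`.

§1 Pure `Λ`-algebra (any `p`), the RATIONAL λ-pinch: if `g·h ≠ 0` and `λ(g·h) ≤ λ(g)` then
`h = p^m · u` with `u ∈ Λˣ` (`exists_eq_C_pow_mul_unit_of_lam_mul_le`); hence a divisibility
`ι(g·h) = pᵐ·L` (Kato's direction, `⊗ℚ`) REVERSES `⊗ℚ`: `p^{m'}·ι(g) = ι(h')·L`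
(`exists_C_pow_mul_iota_eq_of_lam_mul_le`, and the `T·`-version for a trivial zero). Conversely two
opposite `⊗ℚ` divisibilities force `λ(g·h) = λ(g)` (`lam_mul_eq_of_opposite_divisibility`). This is the
`λ`-only half of Greenberg–Vatsal's remark (Invent. Math. 142 (2000) p. 4: «the equality `λ_alg = λ_an`
implies that `f_alg` and `f_an` differ by multiplication by a power of `p`»), which the tree has in the
`μ ∧ λ` form `X1.MuLambda.span_eq_span_iff_mu_lam` (integral equality), in the λ + constant-term form
`span_eq_span_of_lamConstPinch` (p413116) and, in the λ-EQUALITY / `zpow`-exponent currency of the additive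
cell, as `Additive.TameBranchLambdaParity.exists_span_eq_and_iota_eq_zpow_of_lam_eq` (whose unit lemma
`isUnit_pfree_of_lam_eq_zero` is reused here); new here are the `≤` form, the T-mult-4 target shape
`p^m·ι(g) = ι(h')·L` (with and without the trivial-zero factor `T`) and the converse pinning of `λ`.

§2 At a multiplicative `2`: `O1.KatoMultiplicativeDivisibilityRat W 2` (K11, memo PROOF-MULT, referee
RC-2 PASS; `char X ∣ 2ⁿ·L₂` resp. `T·char X ∣ 2ⁿ·L₂`) + the λ-PART «for every factorisation
`ι(f_X·h) = 2ⁿ·L₂(E)` (resp. `ι(T·f_X·h) = 2ⁿ·L₂(E)` at a split `2`): `f_X·h ≠ 0` and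
`λ(f_X·h) ≤ λ(f_X)`» — i.e. `λ_an(E) ≤ λ_alg(E)` with the trivial zero removed and `λ(0) = ∞` — IMPLY
the typed K4ᵐ lower half in rank-free Iwasawa form `O1.MultLowerDivisibilityAtTwoRat W` (T-mult-4,
`X5/TwoAdicTargetsMultConverse.lean`), and CONVERSELY T-mult-4 + K11 give the λ-part back
(`multLambdaPart_iff_multLowerRat_of_katoRat`): given Kato `⊗ℚ`, the open object of the cyclotomic
road is EXACTLY an equality of two integers per curve.

§3 The bridge `multiplicativeRankZeroTwoConverse_of_lambdaPart`: PRINT {Greenberg's Thm-4.1 analogues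
at a multiplicative prime A235 `h41ns` / A236 `h41sp`, modularity `hmod`} + MEMO {K11 `hKato`,
Greenberg–Stevens at `2` `hGS` (PROOF-GS2, RC-4)} + the λ-part ∀-closed over non-CM `E` multiplicative
at `2` ⇒ `MultiplicativeRankZeroTwoConverse` — composition with the landed bridge p411646
`multiplicativeRankZeroTwoConverse_of_multLowerRat`. The 2-converse needs NO `μ`-input (`μ(X) > 0`
does occur at `2`: Greenberg 1999 §5, Prop. 5.13 locus), NO period integrality, NO `BSD₂`, NO upper
half: per class the λ-part is what the cell's two-engine `(μ,λ)_an` tables and the memo-proved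
algebraic λ-law T-LAW (PROOF-LAMBDA2, RC-22 PASS: `λ(X₂(E/ℚ_∞)) = M(N) − 2 − δ` on the A/B/F
2-torsion habitat) certify; ∀-closed it is NOT in print at `p = 2` (no analytic λ-law: Greenberg–Vatsal
2000 and every Eisenstein-congruence argument need `p` odd). PARTITION: none — RANK axis (S3 mult);
companion formula cell X5@2 mult (K4ᵐ, B1·O1; 1 976 classes), owner bsd-2adic.
[cite: GreenbergVatsal2000, p. 4 (after Thm. (1.2))] [cite: Kato2004Asterisque, Thm 17.4 and 17.13]
[cite: GreenbergLNM1716, §4 pp. 112–113] [cite: Washington1997, §7.1]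
-/

set_option autoImplicit false
set_option linter.dupNamespace false

noncomputable section

open scoped Classical MatrixGroups ModularForm

open CongruenceSubgroup WeierstrassCurve Literature.NumberTheory.EllipticCurves
  Literature.NumberTheory.EllipticCurves.ModularForms
  Literature.NumberTheory.EllipticCurves.Greenberg1999
  Literature.NumberTheory.EllipticCurves.Rank1Residual
  Literature.NumberTheory.EllipticCurves.Rank1Residual.Typed
  Summit.BirchSwinnertonDyer.Rank1Residual.X1.MuLambda
  Summit.BirchSwinnertonDyer.Rank1Residual.X5

open Summit.BirchSwinnertonDyer.Rank1Residual.Additive.TameBranchLambdaParity (isUnit_pfree_of_lam_eq_zero)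

namespace Summit.BirchSwinnertonDyer.BirchSwinnertonDyer.Theorems

/-! ## §1 The rational λ-pinch (pure `Λ`-algebra, any prime `p`) -/

section Algebra

variable {p : ℕ} [Fact p.Prime]

/-- `λ(p^k) = 0` and `μ(p^k) = k` (the constant `p^k` has `p`-free part `1`). [cite: Washington1997, §7.1] -/
theorem mu_C_pow_and_lam_C_pow (k : ℕ) :
    mu (PowerSeries.C ((p : ℤ_[p]) ^ k) : IwasawaAlgebra p) = k ∧
      lam (PowerSeries.C ((p : ℤ_[p]) ^ k) : IwasawaAlgebra p) = 0 := by
  have h1 : red (1 : IwasawaAlgebra p) ≠ 0 := by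
    rw [Ne, red, map_one]; exact one_ne_zero
  obtain ⟨hmu, hpf⟩ := mu_eq_and_pfree_eq (g := (PowerSeries.C ((p : ℤ_[p]) ^ k) : IwasawaAlgebra p))
    (a := k) h1 (by rw [mul_one])
  refine ⟨hmu, ?_⟩
  rw [lam, hpf, red, map_one, PowerSeries.order_one]
  rfl

/-- **The rational λ-pinch.** If `g·h ≠ 0` and `λ(g·h) ≤ λ(g)` in `Λ = ℤ_p⟦T⟧`, then `h = p^m · u` for
some `m` and some unit `u` — `λ` is additive, so `λ(h) = 0`, and a nonzero power series with `λ = 0` is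
`p^μ` times a unit. Greenberg–Vatsal p. 4 («`λ_alg = λ_an` implies that `f_alg` and `f_an` differ by
multiplication by a power of `p`»), `λ`-half only: NO `μ`-hypothesis. [cite: GreenbergVatsal2000, p. 4 (after Thm. (1.2))] -/
theorem exists_eq_C_pow_mul_unit_of_lam_mul_le {g h : IwasawaAlgebra p} (hgh : g * h ≠ 0)
    (hle : lam (g * h) ≤ lam g) :
    ∃ (m : ℕ) (u : (IwasawaAlgebra p)ˣ), h = PowerSeries.C ((p : ℤ_[p]) ^ m) * ↑u := by
  have hg : g ≠ 0 := fun h0 => hgh (by rw [h0, zero_mul])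
  have hh : h ≠ 0 := fun h0 => hgh (by rw [h0, mul_zero])
  have hl : lam h = 0 := by
    rw [lam_mul hg hh] at hle
    omega
  obtain ⟨u, hu⟩ := isUnit_pfree_of_lam_eq_zero hh hl
  exact ⟨mu h, u, by rw [hu]; exact eq_C_pow_mu_mul_pfree h⟩

/-- **Kato's `⊗ℚ` direction REVERSES `⊗ℚ` under the λ-part.** If `ι(g·h) = pⁿ·L` (a divisibility
`g ∣ pⁿ·L` in `Λ ⊗ ℚ`, Kato 17.4/17.13 shape) with `g·h ≠ 0` and `λ(g·h) ≤ λ(g)`, then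
`p^m·ι(g) = ι(h')·L` for some `m` and `h' ∈ Λ` (the OPPOSITE divisibility `L ∣ p^m·g` in `Λ ⊗ ℚ`):
with `h = p^m·u`, take `h' = pⁿ·u⁻¹`. [cite: GreenbergVatsal2000, p. 4 (after Thm. (1.2))] -/
theorem exists_C_pow_mul_iota_eq_of_lam_mul_le {g h : IwasawaAlgebra p} {n : ℕ}
    {L : PowerSeries ℚ_[p]} (hgh : g * h ≠ 0) (hle : lam (g * h) ≤ lam g)
    (hι : iwasawaToPowerSeries p (g * h) = PowerSeries.C ((p : ℚ_[p]) ^ n) * L) :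
    ∃ (m : ℕ) (h' : IwasawaAlgebra p),
      PowerSeries.C ((p : ℚ_[p]) ^ m) * iwasawaToPowerSeries p g = iwasawaToPowerSeries p h' * L := by
  obtain ⟨m, u, hu⟩ := exists_eq_C_pow_mul_unit_of_lam_mul_le hgh hle
  refine ⟨m, PowerSeries.C ((p : ℤ_[p]) ^ n) * ↑u⁻¹, ?_⟩
  -- `ι(g)·p^m·ι(u) = pⁿ·L`, multiply by `ι(u⁻¹)`
  have key : iwasawaToPowerSeries p g * PowerSeries.C ((p : ℚ_[p]) ^ m) * iwasawaToPowerSeries p ↑u =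
      PowerSeries.C ((p : ℚ_[p]) ^ n) * L := by
    rw [← hι, hu, map_mul, map_mul, iwasawaToPowerSeries_C_natCast_pow, mul_assoc]
  have huinv : iwasawaToPowerSeries p (↑u : IwasawaAlgebra p) * iwasawaToPowerSeries p ↑u⁻¹ = 1 := by
    rw [← map_mul, Units.mul_inv, map_one]
  calc PowerSeries.C ((p : ℚ_[p]) ^ m) * iwasawaToPowerSeries p g
      = iwasawaToPowerSeries p g * PowerSeries.C ((p : ℚ_[p]) ^ m) *
          (iwasawaToPowerSeries p ↑u * iwasawaToPowerSeries p ↑u⁻¹) := by rw [huinv, mul_one, mul_comm]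
    _ = (iwasawaToPowerSeries p g * PowerSeries.C ((p : ℚ_[p]) ^ m) * iwasawaToPowerSeries p ↑u) *
          iwasawaToPowerSeries p ↑u⁻¹ := by ring
    _ = PowerSeries.C ((p : ℚ_[p]) ^ n) * L * iwasawaToPowerSeries p ↑u⁻¹ := by rw [key]
    _ = iwasawaToPowerSeries p (PowerSeries.C ((p : ℤ_[p]) ^ n) * ↑u⁻¹) * L := by
          rw [map_mul, iwasawaToPowerSeries_C_natCast_pow]; ring

/-- The same with a trivial-zero factor `T` charged outside `g` (split multiplicative shape:
`ι(T·g·h) = pⁿ·L` ⇒ `p^m·ι(T·g) = ι(h')·L`). [cite: GreenbergVatsal2000, p. 4 (after Thm. (1.2))] -/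
theorem exists_C_pow_mul_iota_X_mul_eq_of_lam_mul_le {g h : IwasawaAlgebra p} {n : ℕ}
    {L : PowerSeries ℚ_[p]} (hgh : g * h ≠ 0) (hle : lam (g * h) ≤ lam g)
    (hι : iwasawaToPowerSeries p (PowerSeries.X * (g * h)) = PowerSeries.C ((p : ℚ_[p]) ^ n) * L) :
    ∃ (m : ℕ) (h' : IwasawaAlgebra p),
      PowerSeries.C ((p : ℚ_[p]) ^ m) * iwasawaToPowerSeries p (PowerSeries.X * g) =
        iwasawaToPowerSeries p h' * L := by
  have hXgh : (PowerSeries.X * g) * h ≠ 0 :=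
    mul_ne_zero (mul_ne_zero PowerSeries.X_ne_zero (fun h0 => hgh (by rw [h0, zero_mul])))
      (fun h0 => hgh (by rw [h0, mul_zero]))
  have hle' : lam ((PowerSeries.X * g) * h) ≤ lam (PowerSeries.X * g) := by
    have hg : g ≠ 0 := fun h0 => hgh (by rw [h0, zero_mul])
    have hh : h ≠ 0 := fun h0 => hgh (by rw [h0, mul_zero])
    rw [lam_mul (mul_ne_zero PowerSeries.X_ne_zero hg) hh, lam_mul PowerSeries.X_ne_zero hg]
    rw [lam_mul hg hh] at hle
    omega
  exact exists_C_pow_mul_iota_eq_of_lam_mul_le hXgh hle' (by rw [mul_assoc]; exact hι)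

/-- **Converse of the pinch**: two OPPOSITE `⊗ℚ` divisibilities force the λ-part. If
`ι(g·h) = pⁿ·L` and `p^m·ι(g) = ι(h')·L` with `g ≠ 0`, then `g·h ≠ 0` and `λ(g·h) = λ(g)`
(`p^{m+n}·g = h'·h·g`, so `λ(h') + λ(h) = λ(p^{m+n}) = 0`). [cite: GreenbergVatsal2000, p. 4 (after Thm. (1.2))] -/
theorem lam_mul_eq_of_opposite_divisibility {g h h' : IwasawaAlgebra p} {n m : ℕ}
    {L : PowerSeries ℚ_[p]} (hg : g ≠ 0)
    (hι : iwasawaToPowerSeries p (g * h) = PowerSeries.C ((p : ℚ_[p]) ^ n) * L)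
    (hι' : PowerSeries.C ((p : ℚ_[p]) ^ m) * iwasawaToPowerSeries p g =
      iwasawaToPowerSeries p h' * L) :
    g * h ≠ 0 ∧ lam (g * h) = lam g := by
  -- `ι(p^{m+n}·g) = ι(h'·(g·h))`, hence `p^{m+n}·g = h'·(g·h)` in `Λ`
  have heq : PowerSeries.C ((p : ℤ_[p]) ^ (m + n)) * g = h' * (g * h) := by
    apply iwasawaToPowerSeries_injective p
    have e1 : iwasawaToPowerSeries p (PowerSeries.C ((p : ℤ_[p]) ^ (m + n)) * g) =
        PowerSeries.C ((p : ℚ_[p]) ^ n) * (PowerSeries.C ((p : ℚ_[p]) ^ m) *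
          iwasawaToPowerSeries p g) := by
      rw [map_mul, iwasawaToPowerSeries_C_natCast_pow, pow_add, map_mul]; ring
    have e2 : iwasawaToPowerSeries p (h' * (g * h)) =
        iwasawaToPowerSeries p h' * (PowerSeries.C ((p : ℚ_[p]) ^ n) * L) := by
      rw [map_mul, hι]
    rw [e1, e2, hι']; ring
  have hC : (PowerSeries.C ((p : ℤ_[p]) ^ (m + n)) : IwasawaAlgebra p) ≠ 0 := C_pow_ne_zero (m + n)
  have hgh : g * h ≠ 0 := by
    intro h0
    rw [h0, mul_zero] at heq
    exact (mul_ne_zero hC hg) heq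
  have hh : h ≠ 0 := fun h0 => hgh (by rw [h0, mul_zero])
  have hh' : h' ≠ 0 := by
    intro h0
    rw [h0, zero_mul] at heq
    exact (mul_ne_zero hC hg) heq
  refine ⟨hgh, ?_⟩
  have hl := congrArg lam heq
  rw [lam_mul hC hg, (mu_C_pow_and_lam_C_pow (m + n)).2, lam_mul hh' hgh, lam_mul hg hh] at hl
  rw [lam_mul hg hh]
  omega

end Algebra

/-! ## §2 At a multiplicative `2`: K11 `⊗ℚ` + the λ-part ⟺ K11 `⊗ℚ` + T-mult-4 -/

section AtTwo

variable (W : WeierstrassCurve ℚ)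

/-- A generator of a characteristic ideal over `Λ` is nonzero (`char_Λ M ≠ 0` for every module).
[folklore] -/
theorem generator_ne_zero_of_charIdeal_eq {κ : ZpExtension ℚ 2} {γ : Field.absoluteGaloisGroup ℚ}
    (D : W.SelmerDualData κ γ) {g : IwasawaAlgebra 2} (hchar : D.charIdeal = Ideal.span {g}) :
    g ≠ 0 := by
  intro h0
  refine Module.charIdeal_ne_bot (IwasawaAlgebra 2) D.X ?_
  change D.charIdeal = ⊥
  rw [hchar, h0]
  exact Ideal.span_singleton_eq_bot.mpr rfl

/-- **λ-part ⇒ T-mult-4 (given K11 `⊗ℚ`).** For `E/ℚ` (globally minimal `W`): Kato's `⊗ℚ`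
divisibility at a multiplicative `2` (`O1.KatoMultiplicativeDivisibilityRat W 2`: `ι(g') = 2ⁿ·L₂` with
`g' ∈ char_Λ X`, resp. `ι(T·g') = 2ⁿ·L₂` at a split `2`) together with the λ-PART «for every cyclotomic
datum, newform, dual datum `D` with `char_Λ X = (g)`, every `h ∈ Λ` and `n` with `ι(g·h) = 2ⁿ·L₂`
(resp. `ι(T·g·h) = 2ⁿ·L₂`): `g·h ≠ 0` and `λ(g·h) ≤ λ(g)`» (`λ_an ≤ λ_alg`, trivial zero removed,
`λ(0) = ∞`) IMPLY the lower `⊗ℚ` divisibility T-mult-4 `O1.MultLowerDivisibilityAtTwoRat W`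
(`2^m·ι(f_E) = ι(h')·L₂`, resp. `2^m·ι(T·f_E) = ι(h')·L₂`). Pure algebra (§1) on top of K11.
[cite: GreenbergVatsal2000, p. 4 (after Thm. (1.2))] [cite: Kato2004Asterisque, Thm 17.4 and 17.13] -/
theorem multLowerDivisibilityAtTwoRat_of_katoRat_of_lambdaPart
    (hKato : O1.KatoMultiplicativeDivisibilityRat W 2)
    (hlam : ∀ (κ : ZpExtension ℚ 2) (γ : Field.absoluteGaloisGroup ℚ), κ.IsCyclotomic →
      κ.IsTopGenerator γ → IsCyclotomicVariable 2 γ → Mult W 2 →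
      ∀ ⦃N : ℕ⦄ [NeZero N] (f : CuspForm (Gamma0 N) 2), IsNewformOf W f →
      ∀ (D : W.SelmerDualData κ γ) (g h : IwasawaAlgebra 2) (n : ℕ),
        D.charIdeal = Ideal.span {g} →
        (¬ W.HasSplitMultiplicativeReductionAtPrime 2 →
          ∀ L : PowerSeries ℚ_[2], IsMultPAdicLFunctionOf f 2 (-1) L →
            iwasawaToPowerSeries 2 (g * h) = PowerSeries.C ((2 : ℚ_[2]) ^ n) * L →
            g * h ≠ 0 ∧ lam (g * h) ≤ lam g) ∧
        (W.HasSplitMultiplicativeReductionAtPrime 2 →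
          ∀ L : PowerSeries ℚ_[2], IsSplitMultPAdicLFunctionOf f 2 L →
            iwasawaToPowerSeries 2 (PowerSeries.X * (g * h)) = PowerSeries.C ((2 : ℚ_[2]) ^ n) * L →
            g * h ≠ 0 ∧ lam (g * h) ≤ lam g)) :
    O1.MultLowerDivisibilityAtTwoRat W := by
  intro κ γ hκ hγ hγ' hmult N _ f hf D fE hchar
  obtain ⟨-, hns, hsp⟩ := hKato κ γ hκ hγ hγ' hmult f hf D
  have h22 : ((2 : ℕ) : ℚ_[2]) = (2 : ℚ_[2]) := by norm_num
  refine ⟨fun hns' L hL => ?_, fun hsp' L hL => ?_⟩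
  · obtain ⟨n, g', hg', hι⟩ := hns hns' L hL
    rw [hchar] at hg'
    obtain ⟨a, ha⟩ := Ideal.mem_span_singleton'.mp hg'
    have hι2 : iwasawaToPowerSeries 2 (fE * a) = PowerSeries.C ((2 : ℚ_[2]) ^ n) * L := by
      rw [mul_comm, ha, hι, h22]
    obtain ⟨hne, hle⟩ := (hlam κ γ hκ hγ hγ' hmult f hf D fE a n hchar).1 hns' L hL hι2
    have hι3 : iwasawaToPowerSeries 2 (fE * a) = PowerSeries.C (((2 : ℕ) : ℚ_[2]) ^ n) * L := by
      rw [h22]; exact hι2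
    obtain ⟨m, h', hm⟩ := exists_C_pow_mul_iota_eq_of_lam_mul_le hne hle hι3
    exact ⟨m, h', by rw [← h22]; exact hm⟩
  · obtain ⟨n, g', hg', hι⟩ := hsp hsp' L hL
    rw [hchar] at hg'
    obtain ⟨a, ha⟩ := Ideal.mem_span_singleton'.mp hg'
    have hι2 : iwasawaToPowerSeries 2 (PowerSeries.X * (fE * a)) =
        PowerSeries.C ((2 : ℚ_[2]) ^ n) * L := by
      rw [mul_comm fE a, ha, hι, h22]
    obtain ⟨hne, hle⟩ := (hlam κ γ hκ hγ hγ' hmult f hf D fE a n hchar).2 hsp' L hL hι2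
    have hι3 : iwasawaToPowerSeries 2 (PowerSeries.X * (fE * a)) =
        PowerSeries.C (((2 : ℕ) : ℚ_[2]) ^ n) * L := by
      rw [h22]; exact hι2
    obtain ⟨m, h', hm⟩ := exists_C_pow_mul_iota_X_mul_eq_of_lam_mul_le hne hle hι3
    exact ⟨m, h', by rw [← h22]; exact hm⟩

/-- **T-mult-4 ⇒ λ-part (given nothing more): two opposite `⊗ℚ` divisibilities pin `λ`.** If
`O1.MultLowerDivisibilityAtTwoRat W` holds then every factorisation `ι(g·h) = 2ⁿ·L₂` (resp.
`ι(T·g·h) = 2ⁿ·L₂`) through a generator `g` of `char_Λ X` has `g·h ≠ 0` and `λ(g·h) ≤ λ(g)` (indeed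
`=`). With `multLowerDivisibilityAtTwoRat_of_katoRat_of_lambdaPart`: modulo K11 `⊗ℚ` the typed open
object T-mult-4 of the cyclotomic road IS the λ-part — an equality of two integers per curve.
[cite: GreenbergVatsal2000, p. 4 (after Thm. (1.2))] -/
theorem multLambdaPart_of_multLowerRat (hlow : O1.MultLowerDivisibilityAtTwoRat W) :
    ∀ (κ : ZpExtension ℚ 2) (γ : Field.absoluteGaloisGroup ℚ), κ.IsCyclotomic →
      κ.IsTopGenerator γ → IsCyclotomicVariable 2 γ → Mult W 2 →
      ∀ ⦃N : ℕ⦄ [NeZero N] (f : CuspForm (Gamma0 N) 2), IsNewformOf W f →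
      ∀ (D : W.SelmerDualData κ γ) (g h : IwasawaAlgebra 2) (n : ℕ),
        D.charIdeal = Ideal.span {g} →
        (¬ W.HasSplitMultiplicativeReductionAtPrime 2 →
          ∀ L : PowerSeries ℚ_[2], IsMultPAdicLFunctionOf f 2 (-1) L →
            iwasawaToPowerSeries 2 (g * h) = PowerSeries.C ((2 : ℚ_[2]) ^ n) * L →
            g * h ≠ 0 ∧ lam (g * h) ≤ lam g) ∧
        (W.HasSplitMultiplicativeReductionAtPrime 2 →
          ∀ L : PowerSeries ℚ_[2], IsSplitMultPAdicLFunctionOf f 2 L →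
            iwasawaToPowerSeries 2 (PowerSeries.X * (g * h)) = PowerSeries.C ((2 : ℚ_[2]) ^ n) * L →
            g * h ≠ 0 ∧ lam (g * h) ≤ lam g) := by
  intro κ γ hκ hγ hγ' hmult N _ f hf D g h n hchar
  have hg : g ≠ 0 := generator_ne_zero_of_charIdeal_eq W D hchar
  have h22 : ((2 : ℕ) : ℚ_[2]) = (2 : ℚ_[2]) := by norm_num
  obtain ⟨hns, hsp⟩ := hlow κ γ hκ hγ hγ' hmult f hf D g hchar
  refine ⟨fun hns' L hL hι => ?_, fun hsp' L hL hι => ?_⟩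
  · obtain ⟨m, h', hm⟩ := hns hns' L hL
    rw [← h22] at hι hm
    obtain ⟨hne, heq⟩ := lam_mul_eq_of_opposite_divisibility hg hι hm
    exact ⟨hne, heq.le⟩
  · obtain ⟨m, h', hm⟩ := hsp hsp' L hL
    rw [← h22] at hι hm
    have hXg : PowerSeries.X * g ≠ 0 := mul_ne_zero PowerSeries.X_ne_zero hg
    have hι' : iwasawaToPowerSeries 2 (PowerSeries.X * g * h) =
        PowerSeries.C (((2 : ℕ) : ℚ_[2]) ^ n) * L := by rw [mul_assoc]; exact hι
    obtain ⟨hne, heq⟩ := lam_mul_eq_of_opposite_divisibility hXg hι' hm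
    have hh : h ≠ 0 := fun h0 => hne (by rw [h0, mul_zero])
    refine ⟨mul_ne_zero hg hh, ?_⟩
    rw [lam_mul hXg hh, lam_mul PowerSeries.X_ne_zero hg] at heq
    rw [lam_mul hg hh]
    omega

end AtTwo

/-! ## §3 The bridge: PRINT + MEMO + the λ-part ∀-closed ⇒ `MultiplicativeRankZeroTwoConverse` -/

/-- **Bridge (λ-road ⇒ crux, item stmt-BirchSwinnertonDyer-19219).** PRINT {Greenberg's Thm-4.1
analogues at a multiplicative prime, non-split A235 `h41ns` / split A236 `h41sp`; modularity `hmod`} +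
MEMO {Kato `⊗ℚ` at a multiplicative `2` `hKato` (K11, PROOF-MULT, referee RC-2 PASS; used for «`X`
torsion» and the divisibility `char X ∣ 2ⁿL₂`), Greenberg–Stevens at `2` `hGS` (PROOF-GS2, RC-4 PASS,
split case)} + the λ-PART ∀-closed over non-CM `E/ℚ` multiplicative at `2` (`hlam`: «`λ(2ⁿ·L₂(E)) ≤
λ(char X(E/ℚ_∞))`, trivial zero removed, `2ⁿL₂ ≠ 0`») ⇒ `MultiplicativeRankZeroTwoConverse`
(`corank Sel_{2^∞}(E/ℚ) = 0 ⇒ r_an(E) = 0`). Composition: §2 gives T-mult-4 for every such `E`, then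
the landed bridge p411646 `multiplicativeRankZeroTwoConverse_of_multLowerRat` (control A235/A236 ⇒
`f_E(0) ≠ 0` ⇒ `L₂(0) ≠ 0` resp. `[T¹]L₂ ≠ 0` ⇒ Greenberg–Stevens ⇒ `L(E,1) ≠ 0`). NO `μ`-hypothesis
(`μ(X) > 0` occurs at `2`), NO period integrality, NO `BSD₂`, NO upper half. Nothing asserted.
[cite: GreenbergVatsal2000, p. 4 (after Thm. (1.2))] [cite: GreenbergLNM1716, §4 pp. 112–113]
[cite: Kato2004Asterisque, Thm 17.4 and 17.13] [cite: MazurTateTeitelbaum1986Invent, §I.14] -/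
theorem multiplicativeRankZeroTwoConverse_of_lambdaPart
    (h41ns : thm41Analogue_charValue_rankZero_numberField_anyPrime)
    (h41sp : thm41Analogue_charValue_rankZero_split_baseChange_anyPrime)
    (hmod : nonempty_modularParametrizationData)
    (hKato : ∀ (W : WeierstrassCurve ℚ) [W.IsElliptic] [W.IsGloballyMinimal],
      ¬ W.HasCM → Mult W 2 → O1.KatoMultiplicativeDivisibilityRat W 2)
    (hGS : ∀ (W : WeierstrassCurve ℚ) [W.IsElliptic] [W.IsGloballyMinimal],
      W.HasSplitMultiplicativeReductionAtPrime 2 → greenberg_stevens (W := W) (p := 2))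
    (hlam : ∀ (W : WeierstrassCurve ℚ) [W.IsElliptic] [W.IsGloballyMinimal], ¬ W.HasCM → Mult W 2 →
      ∀ (κ : ZpExtension ℚ 2) (γ : Field.absoluteGaloisGroup ℚ), κ.IsCyclotomic →
      κ.IsTopGenerator γ → IsCyclotomicVariable 2 γ → Mult W 2 →
      ∀ ⦃N : ℕ⦄ [NeZero N] (f : CuspForm (Gamma0 N) 2), IsNewformOf W f →
      ∀ (D : W.SelmerDualData κ γ) (g h : IwasawaAlgebra 2) (n : ℕ),
        D.charIdeal = Ideal.span {g} →
        (¬ W.HasSplitMultiplicativeReductionAtPrime 2 →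
          ∀ L : PowerSeries ℚ_[2], IsMultPAdicLFunctionOf f 2 (-1) L →
            iwasawaToPowerSeries 2 (g * h) = PowerSeries.C ((2 : ℚ_[2]) ^ n) * L →
            g * h ≠ 0 ∧ lam (g * h) ≤ lam g) ∧
        (W.HasSplitMultiplicativeReductionAtPrime 2 →
          ∀ L : PowerSeries ℚ_[2], IsSplitMultPAdicLFunctionOf f 2 L →
            iwasawaToPowerSeries 2 (PowerSeries.X * (g * h)) = PowerSeries.C ((2 : ℚ_[2]) ^ n) * L →
            g * h ≠ 0 ∧ lam (g * h) ≤ lam g)) :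
    Summit.BirchSwinnertonDyer.BirchSwinnertonDyer.Theses.TwoAdicConverse.MultiplicativeRankZeroTwoConverse :=
  multiplicativeRankZeroTwoConverse_of_multLowerRat h41ns h41sp hmod hKato hGS
    (fun W _ _ hcm hmult =>
      multLowerDivisibilityAtTwoRat_of_katoRat_of_lambdaPart W (hKato W hcm hmult) (hlam W hcm hmult))

end Summit.BirchSwinnertonDyer.BirchSwinnertonDyer.Theorems

end
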